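import Summits.AnomalousDissipation.AnomalousDissipation.Theorems.SolenoidalFractalHomogenisationLagrangianStepVmodSlowTestTools
import Summits.AnomalousDissipation.AnomalousDissipation.Theorems.SolenoidalFractalHomogenisationLagrangianStepVmodGeneratorPairing
import Summits.AnomalousDissipation.AnomalousDissipation.Theorems.SolenoidalFractalHomogenisationLagrangianStepVmodSSReduce
import Summits.AnomalousDissipation.AnomalousDissipation.Theorems.SolenoidalFractalHomogenisationLagrangianStepVmodCoarseSupp
import Summits.AnomalousDissipation.AnomalousDissipation.Theorems.SolenoidalFractalHomogenisationLagrangianStepCellCorrectorContent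
import Summits.AnomalousDissipation.AnomalousDissipation.Theorems.SolenoidalFractalHomogenisationLagrangianStepVmodFastModeGenerator
import Literature.Analysis.FluidPDE.PassiveVectorTensorPropagatorTestIdentity
import Literature.NumberTheory.LFunctions.PrimeReciprocalWindows
import HarnessLib

/-!
# K1L_D (stmt-AnomalousDissipation-27980), (V_mod) flat stage (ℓ2): the (fs) block — FAST datum, SLOW test — on SHORT windows, in loss currency
# (the «generator» row of the certifier's table `Cruxes/LagrangianRenormalisationStep/Lines/onelevel-ss-regimes.md` §4 (fs) / R-CHECK PASS 08:31Z,
# ALL phases `s`; prover ad-k1loc-p3 g10, `--supports 27980 --as helper`)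

In the variables of `VmodFlat.BlockBound` (cell member `U` = propagator of `cellField W M hM ν n` with tensor `(1/n²)𝔸`, coarse member `T` = carrier-free
propagator with tensor `(1/n²)(𝔸 + (c/ν)Φ)`, `x` fast = no modes in `freqBall (n/4)`, `ζ` slow = only such modes) and on windows with
`8π²·loT·(n/4)²·(t − s) ≤ 1` (`loT = (1/n²)(ν + c/ν)(lo/Λ)`, `…VmodSSReduce`; i.e. `t − s ≲ 2νΛ/(π²c·lo)`, the certifier's `τ⋆`):

  `|⟪U s t x − T s t x, ζ⟫| ≤ ν·Λ·(k + hi·Λ + β)/(c·lo) · √(lossFwd (T s t) x) · √(lossAdj (T s t) ζ)`     (`fs_pairing_le_of_short_window`)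

— a ν-SMALL constant, free of `n`, of the labels and of the phase `s` (`k` = the number of slots of the word `W`).  Proof = the generator row:
(1) `⟪T x, P_σζ⟫ = 0 = ⟪x, P_σζ⟫` (the coarse member keeps `x` fast, `coarseSupp`; fast ⟂ slow), and the test is seen through `P_σ ζ`, a slow solenoidal
class = the smooth trigonometric polynomial `G = P_{n/4} P_σζ` (`toLp_fourierTruncate_eq_of_isSlow`); (2) du Bois-Reymond at propagator level
(`IsPropagator.inner_eq_inner_add_setIntegral_of_steadyTest`, p710945): `⟪U s t x, G⟫ = ∫_{(s,t]} ∫⟪U s τ x, (b(τ)·∇)G + 𝓛^*G⟫`; (3) the test-side generator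
bound (`abs_integral_inner_generator_fourierTruncate_le`, p711586) with `‖cellField‖_∞ ≤ k/(2πn)`: integrand `≤ (3k/n + 4π²ν(hiΛ + β/2)(n/4)/n²)·S·‖x‖`,
`S² = Σ_{|ℓ|≤n/4} |ℓ|²‖(P_σζ)^(ℓ)‖²`; (4) the currency: `lossFwd ≥ (1 − e^{−a(n/4)²})‖x‖²` (`lossFwd_ge_of_supp`), `lossAdj ≥ Σ(1 − e^{−a|ℓ|²})‖(P_σζ)^(ℓ)‖²`
(`lossAdj_ge_sum_modes` + `lossAdj_starProjection_le`), `a = 8π²·loT·(t−s)`, and `1 − e^{−y} ≥ y/2` on `[0,1]` — the window `t − s` CANCELS.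
The intermediate (leak, L-lk) and long ((V)-iterated / W7) windows of (fs) are NOT treated here.  NOT a proof of `Bfs_textEVH`, of `stub_Vmod_of_VRH`,
of K1L_D or of AD; rung F-D1.A0.
-/

set_option linter.dupNamespace false

noncomputable section

namespace Summit.AnomalousDissipation.AnomalousDissipation.Theorems.SolenoidalFractalHomogenisation.LagrangianStep.VmodFlat

open Literature.Analysis Literature.Analysis.FluidPDE Literature.Analysis.FunctionSpaces
open MeasureTheory Set Filter UnitAddTorus
open scoped ENNReal NNReal InnerProductSpace
open Summit.AnomalousDissipation.AnomalousDissipation.Theorems.SolenoidalFractalHomogenisation.LagrangianStep.CellClauseMod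
open Summit.AnomalousDissipation.AnomalousDissipation.Theorems.SolenoidalFractalHomogenisation.RealisedQuasiStaticCellLaw
  (isSmooth_cell isDivFree_cell memLp_top_stLift_cell)

/-! ## §1 Elementary -/

/-- **The constant comparison behind the (fs) short-window bound**: transport `3k/n ≤ 4π²kN/n²` (as `n ≤ 7N`, `21 ≤ 4π²`) and diffusion
`ν(hi·λ + β/2) ≤ hiΛ + β`, against `Cfs·4π²·L·N ≥ 4π²(k + hiΛ + β)N/n²` (`L ≥ (c/ν)(lo/Λ)/n²`, `Cfs = νΛ(k + hiΛ + β)/(c·lo)`). [folklore] -/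
theorem fs_const_le {ν c lo Λ hi lam β k n N L : ℝ} (hν : 0 < ν) (hν1 : ν ≤ 1) (hc : 0 < c) (hlo : 0 < lo) (hΛ : 1 ≤ Λ)
    (hhi : 0 ≤ hi) (hβ : 0 ≤ β) (hk : 0 ≤ k) (hn : 0 < n) (hN : 0 ≤ N) (hnN : n ≤ 7 * N) (hlam0 : 0 ≤ lam) (hlam : lam ≤ Λ)
    (hL : (c / ν) * (lo / Λ) / n ^ 2 ≤ L) :
    6 * Real.pi * (k / (2 * Real.pi * n)) + 4 * Real.pi ^ 2 * ((1 / n ^ 2) * (ν * (hi * lam)) + (1 / n ^ 2) * (ν * β) / 2) * N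
      ≤ (ν * Λ * (k + hi * Λ + β) / (c * lo)) * (4 * Real.pi ^ 2 * L) * N := by
  have hReal.pi : 0 < Real.pi := Real.pi_pos
  have hReal.pi3 : 3 < Real.pi := Real.pi_gt_three
  have hΛ0 : 0 < Λ := by linarith
  have hn2 : 0 < n ^ 2 := by positivity
  -- the right side is at least `4Real.pi² (k + hiΛ + β) N / n²`
  have hD : (ν * Λ * (k + hi * Λ + β) / (c * lo)) * (4 * Real.pi ^ 2 * ((c / ν) * (lo / Λ) / n ^ 2)) * N
      = 4 * Real.pi ^ 2 * (k + hi * Λ + β) * N / n ^ 2 := by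
    field_simp
  have hfac : 0 ≤ (ν * Λ * (k + hi * Λ + β) / (c * lo)) := by positivity
  have hR : 4 * Real.pi ^ 2 * (k + hi * Λ + β) * N / n ^ 2 ≤ (ν * Λ * (k + hi * Λ + β) / (c * lo)) * (4 * Real.pi ^ 2 * L) * N := by
    rw [← hD]
    have : 4 * Real.pi ^ 2 * ((c / ν) * (lo / Λ) / n ^ 2) ≤ 4 * Real.pi ^ 2 * L := by nlinarith [hL]
    exact mul_le_mul_of_nonneg_right (mul_le_mul_of_nonneg_left this hfac) hN
  refine le_trans ?_ hR
  -- the left side is `3k/n + 4Real.pi² ν (hi lam + β/2) N / n²`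
  have hL1 : 6 * Real.pi * (k / (2 * Real.pi * n)) = 3 * k / n := by field_simp; ring
  have hL2 : 4 * Real.pi ^ 2 * ((1 / n ^ 2) * (ν * (hi * lam)) + (1 / n ^ 2) * (ν * β) / 2) * N
      = 4 * Real.pi ^ 2 * (ν * (hi * lam) + ν * β / 2) * N / n ^ 2 := by field_simp
  rw [hL1, hL2]
  -- transport: `3k/n ≤ 4Real.pi² k N / n²`
  have hT : 3 * k / n ≤ 4 * Real.pi ^ 2 * k * N / n ^ 2 := by
    rw [div_le_div_iff₀ hn hn2]
    have h1 : 3 * n ≤ 4 * Real.pi ^ 2 * N := by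
      have hReal.pi9 : 9 < Real.pi ^ 2 := by nlinarith
      nlinarith
    calc 3 * k * n ^ 2 = (3 * n) * (k * n) := by ring
      _ ≤ (4 * Real.pi ^ 2 * N) * (k * n) := mul_le_mul_of_nonneg_right h1 (by positivity)
      _ = 4 * Real.pi ^ 2 * k * N * n := by ring
  -- diffusion: `ν (hi lam + β/2) ≤ hi Λ + β`
  have hV : ν * (hi * lam) + ν * β / 2 ≤ hi * Λ + β := by
    have h3 : ν * (hi * lam) ≤ 1 * (hi * Λ) := by gcongr
    nlinarith
  have hV' : 4 * Real.pi ^ 2 * (ν * (hi * lam) + ν * β / 2) * N / n ^ 2 ≤ 4 * Real.pi ^ 2 * (hi * Λ + β) * N / n ^ 2 := by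
    apply div_le_div_of_nonneg_right _ hn2.le
    exact mul_le_mul_of_nonneg_right (mul_le_mul_of_nonneg_left hV (by positivity)) hN
  have e : 4 * Real.pi ^ 2 * (k + hi * Λ + β) * N / n ^ 2 = 4 * Real.pi ^ 2 * k * N / n ^ 2 + 4 * Real.pi ^ 2 * (hi * Λ + β) * N / n ^ 2 := by ring
  rw [e]
  exact add_le_add hT hV'

/-- For `n ≥ 4`, `n ≤ 7·⌊n/4⌋`. [folklore] -/
theorem nat_le_seven_mul_div_four {n : ℕ} (hn : 4 ≤ n) : (n : ℝ) ≤ 7 * ((n / 4 : ℕ) : ℝ) := by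
  have h : n ≤ 7 * (n / 4) := by omega
  exact_mod_cast h

/-! ## §2 The (fs) pairing on short windows -/

set_option maxHeartbeats 1600000 in
/-- **(fs) ON SHORT WINDOWS, IN LOSS CURRENCY** (generator row, every phase `s`): for a FAST datum `x` and a SLOW test `ζ`, on every window with
`8π²·loT·⌊n/4⌋²·(t − s) ≤ 1`,
`|⟪U s t x − T s t x, ζ⟫| ≤ ν·Λ·(k + hi·Λ + β)/(c·lo) · √(lossFwd (T s t) x) · √(lossAdj (T s t) ζ)`. -/
theorem fs_pairing_le_of_short_window {k : ℕ} (W : LatticeShear.LatticeWord k) (M : ℝ) (hM : 0 < M) {c : ℝ} (hc : 0 < c)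
    (Φ : ℝ → Torus.Visc4 (Fin 3) → Torus.Visc4 (Fin 3)) {lo hi Λ β ν₀ K : ℝ}
    (hlo : 0 < lo) (hhi : 1 ≤ hi) (hΛ : 1 < Λ) (hβ : 0 ≤ β) (hν₀ : ν₀ ≤ 1) (hK : 0 < K)
    {ν : ℝ} (hν : ν ∈ Set.Ioo 0 ν₀) {n : ℕ} (hn : (⌈K / ν⌉₊ : ℝ) ≤ n) {𝔸 : Torus.Visc4 (Fin 3)}
    (hodd : Torus.OddSmall 𝔸 (ν * β)) (hwin : ∃ lam ∈ Set.Icc (1:ℝ) Λ, Torus.NearIso 𝔸 (ν * (lo / lam)) (ν * (hi * lam)))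
    (hΦw : ∃ lam ∈ Set.Icc (1:ℝ) Λ, Torus.NearIso (Φ ν ((1 / ν) • 𝔸)) (lo / lam) (hi * lam))
    {Tw : ℝ} {U T : ℝ → ℝ → (V2 →L[ℝ] V2)}
    (hU : Torus.IsPropagator Tw (cellField W M hM ν hν.1 n) ((1 / (n:ℝ) ^ 2) • 𝔸) U)
    (hT : Torus.IsPropagator Tw (fun _ _ => 0) ((1 / (n:ℝ) ^ 2) • (𝔸 + (c / ν) • Φ ν ((1 / ν) • 𝔸))) T)
    {s t : ℝ} (hs : 0 ≤ s) (hst : s < t) (htT : t ≤ Tw) (x ζ : V2) (hx : IsFast n x) (hζ : IsSlow n ζ)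
    (hshort : 8 * Real.pi ^ 2 * loT lo Λ c ν n * ((n / 4 : ℕ) : ℝ) ^ 2 * (t - s) ≤ 1) :
    |⟪U s t x - T s t x, ζ⟫_ℝ|
      ≤ (ν * Λ * (k + hi * Λ + β) / (c * lo)) * Real.sqrt (lossFwd (T s t) x) * Real.sqrt (lossAdj (T s t) ζ) := by
  -- the resolution
  have hn1 : (1:ℝ) ≤ n := by
    have h1 : (1:ℝ) ≤ ⌈K / ν⌉₊ := by
      have : 0 < K / ν := div_pos hK hν.1
      exact_mod_cast Nat.one_le_iff_ne_zero.2 (Nat.pos_iff_ne_zero.1 (Nat.ceil_pos.2 this))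
    exact h1.trans hn
  have hnpos : 0 < n := by exact_mod_cast (show (0:ℝ) < n by linarith)
  have hn0 : (0:ℝ) < n := by exact_mod_cast hnpos
  have hν0 : 0 < ν := hν.1
  have hν1 : ν ≤ 1 := hν.2.le.trans hν₀
  have hΛ0 : 0 < Λ := by linarith
  have hΛ1 : 1 ≤ Λ := hΛ.le
  have hhi0 : 0 ≤ hi := by linarith
  set N₄ : ℕ := n / 4 with hN₄
  set P := (Torus.divFreeL2 (Fin 3)).starProjection with hP
  -- ellipticity windows
  obtain ⟨lam, hlam, hA𝔸⟩ := hwin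
  obtain ⟨lam', hlam', hΦn⟩ := hΦw
  have hlam0 : 0 < lam := by linarith [hlam.1]
  have hlam'0 : 0 < lam' := by linarith [hlam'.1]
  have hcν : 0 ≤ c / ν := div_nonneg hc.le hν0.le
  have hn2 : (0:ℝ) < 1 / (n:ℝ) ^ 2 := by positivity
  have hcell : Torus.NearIso ((1 / (n:ℝ) ^ 2) • 𝔸) ((1 / (n:ℝ) ^ 2) * (ν * (lo / lam))) ((1 / (n:ℝ) ^ 2) * (ν * (hi * lam))) :=
    hA𝔸.smul hn2.le
  have hcell_lo : 0 ≤ (1 / (n:ℝ) ^ 2) * (ν * (lo / lam)) := (mul_pos hn2 (mul_pos hν0 (div_pos hlo hlam0))).le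
  have hcell_hi : 0 ≤ (1 / (n:ℝ) ^ 2) * (ν * (hi * lam)) := by positivity
  have hcell_odd : Torus.OddSmall ((1 / (n:ℝ) ^ 2) • 𝔸) ((1 / (n:ℝ) ^ 2) * (ν * β)) := hodd.smul _
  have hcell_β : 0 ≤ (1 / (n:ℝ) ^ 2) * (ν * β) := by positivity
  have hcoarse0 : Torus.NearIso ((1 / (n:ℝ) ^ 2) • (𝔸 + (c / ν) • Φ ν ((1 / ν) • 𝔸)))
      ((1 / (n:ℝ) ^ 2) * (ν * (lo / lam) + (c / ν) * (lo / lam'))) ((1 / (n:ℝ) ^ 2) * (ν * (hi * lam) + (c / ν) * (hi * lam'))) :=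
    (hA𝔸.add (hΦn.smul hcν)).smul hn2.le
  have hloT_le : loT lo Λ c ν n ≤ (1 / (n:ℝ) ^ 2) * (ν * (lo / lam) + (c / ν) * (lo / lam')) := by
    unfold loT
    have h1 : lo / Λ ≤ lo / lam := div_le_div_of_nonneg_left hlo.le hlam0 hlam.2
    have h2 : lo / Λ ≤ lo / lam' := div_le_div_of_nonneg_left hlo.le hlam'0 hlam'.2
    have h3 : (ν + c / ν) * (lo / Λ) ≤ ν * (lo / lam) + (c / ν) * (lo / lam') := by
      have := mul_le_mul_of_nonneg_left h1 hν0.le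
      have := mul_le_mul_of_nonneg_left h2 hcν
      nlinarith
    exact mul_le_mul_of_nonneg_left h3 hn2.le
  have hloT : 0 < loT lo Λ c ν n := by
    unfold loT
    have hνc : 0 < ν + c / ν := by positivity
    exact mul_pos hn2 (mul_pos hνc (div_pos hlo hΛ0))
  have hcoarse : Torus.NearIso ((1 / (n:ℝ) ^ 2) • (𝔸 + (c / ν) • Φ ν ((1 / ν) • 𝔸)))
      (loT lo Λ c ν n) ((1 / (n:ℝ) ^ 2) * (ν * (hi * lam) + (c / ν) * (hi * lam'))) := hcoarse0.mono hloT_le le_rfl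
  -- carrier data of the cell member on the longer horizon `Tw + 1`
  have hbU : MemLp (Torus.stLift (cellField W M hM ν hν.1 n)) ∞ (volume.restrict (Ioo 0 (Tw + 1) ×ˢ (univ : Set (EuclideanSpace ℝ (Fin 3))))) :=
    memLp_top_stLift_cell _ n (Tw + 1)
  have hbUdiv : ∀ᵐ τ ∂(volume.restrict (Ioo (0:ℝ) (Tw + 1))), Torus.IsWeaklyDivFree (cellField W M hM ν hν.1 n τ) :=
    ae_of_all _ fun τ => (isDivFree_cell _ n τ).isWeaklyDivFree_holds (isSmooth_cell _ n τ)
  have hB : ∀ τ y, ‖cellField W M hM ν hν.1 n τ y‖ ≤ k / (2 * Real.pi * n) := fun τ y => by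
    unfold cellField; exact norm_cell_le_div _ hnpos τ y
  have hB0 : 0 ≤ k / (2 * Real.pi * n) := by positivity
  -- the test: its Leray projection is a slow solenoidal class = a smooth divergence-free trigonometric polynomial
  set ζ' : V2 := P ζ with hζ'def
  have hζ's : IsSlow n ζ' := isSlow_starProjection hζ
  have hζ'div : Torus.IsWeaklyDivFree (ζ' : VF) := Torus.isWeaklyDivFree_starProjection ζ
  have hζ'mem : MemLp (ζ' : VF) 2 volume := Lp.memLp ζ'
  set G : VF := Torus.fourierTruncate N₄ (ζ' : VF) with hGdef
  have hG : Torus.IsSmooth G := Torus.isSmooth_fourierTruncate N₄ _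
  have hGdiv : Torus.IsDivFree G := Torus.isDivFree_fourierTruncate hζ'mem hζ'div N₄
  have hG' : (hG.memLp 2).toLp G = ζ' := toLp_fourierTruncate_eq_of_isSlow ζ' hζ's
  -- Step A: the pairing is `⟪U s t x, ζ'⟫`
  have hTx : ⟪T s t x, ζ'⟫_ℝ = 0 := by
    refine inner_eq_zero_of_fc_disjoint fun k' => ?_
    by_cases hk' : k' ∈ Torus.freqBall (d := Fin 3) (n / 4)
    · exact Or.inl ((coarseSupp Tw _ _ _ hloT hcoarse T hT s t hs hst.le htT x k' (hx k' hk')).1)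
    · exact Or.inr (hζ's k' hk')
  have hxζ : ⟪x, ζ'⟫_ℝ = 0 := by
    refine inner_eq_zero_of_fc_disjoint fun k' => ?_
    by_cases hk' : k' ∈ Torus.freqBall (d := Fin 3) (n / 4)
    · exact Or.inl (hx k' hk')
    · exact Or.inr (hζ's k' hk')
  have hA : ⟪U s t x - T s t x, ζ⟫_ℝ = ⟪U s t x, ζ'⟫_ℝ := by
    rw [inner_propagator_sub_eq_inner_starProjection hU hT s t x ζ, ← hζ'def, inner_sub_left, hTx, sub_zero]
  -- Step B: the du Bois-Reymond identity and the generator bound on its integrand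
  have hTw1 : Tw < Tw + 1 := by linarith
  set g : ℝ → ℝ := fun τ => ∫ z, ⟪((U s τ x : V2) : VF) z,
      Torus.convect (cellField W M hM ν hν.1 n τ) G z + Torus.viscAdj ((1 / (n:ℝ) ^ 2) • 𝔸) G z⟫_ℝ with hgdef
  have hid : ⟪U s t x, ζ'⟫_ℝ = ⟪x, ζ'⟫_ℝ + ∫ τ in Ioc s t, g τ := by
    have h := hU.inner_eq_inner_add_setIntegral_of_steadyTest hcell (mul_pos hn2 (mul_pos hν0 (div_pos hlo hlam0))) hTw1 hbU hbUdiv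
      hG hGdiv hs hst.le htT x
    rw [hG'] at h
    exact h
  set S2 : ℝ := ∑ k' ∈ Torus.freqBall N₄, Torus.freqNormSq k' * ‖mFourierCoeff (EuclideanSpace.complexify ∘ (ζ' : VF)) k'‖ ^ 2 with hS2
  have hS2_0 : 0 ≤ S2 := Finset.sum_nonneg fun k' _ => mul_nonneg (Torus.freqNormSq_nonneg k') (sq_nonneg _)
  set A : ℝ := 6 * Real.pi * ((k:ℝ) / (2 * Real.pi * (n:ℝ))) +
      4 * Real.pi ^ 2 * ((1 / (n:ℝ) ^ 2) * (ν * (hi * lam)) + (1 / (n:ℝ) ^ 2) * (ν * β) / 2) * (N₄:ℝ) with hAdef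
  have hA0 : 0 ≤ A := by positivity
  have hg : ∀ τ, |g τ| ≤ A * Real.sqrt S2 * ‖x‖ := by
    intro τ
    have hu : MemLp ((U s τ x : V2) : VF) 2 volume := Lp.memLp _
    have hudiv : Torus.IsWeaklyDivFree ((U s τ x : V2) : VF) := hU.divFree s τ x
    have hb : AEStronglyMeasurable (cellField W M hM ν hν.1 n τ) volume := (isSmooth_cell _ n τ).continuous.aestronglyMeasurable
    have key := abs_integral_inner_generator_fourierTruncate_le hu hudiv hb hB0 (hB τ) hζ'mem hζ'div hcell hcell_lo hcell_hi hcell_odd hcell_β N₄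
    have hnorm : Real.sqrt (∫ z, ‖((U s τ x : V2) : VF) z‖ ^ 2) ≤ ‖x‖ := by
      rw [← norm_sq_eq_integral_coe, Real.sqrt_sq (norm_nonneg _)]
      exact hU.norm_le s τ x
    calc |g τ| ≤ A * Real.sqrt S2 * Real.sqrt (∫ z, ‖((U s τ x : V2) : VF) z‖ ^ 2) := key
      _ ≤ A * Real.sqrt S2 * ‖x‖ := mul_le_mul_of_nonneg_left hnorm (mul_nonneg hA0 (Real.sqrt_nonneg _))
  have hts : 0 < t - s := sub_pos.2 hst
  have hint : |∫ τ in Ioc s t, g τ| ≤ A * Real.sqrt S2 * ‖x‖ * (t - s) := by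
    have h := norm_setIntegral_le_of_norm_le_const_ae' (f := g) (s := Ioc s t) (μ := volume) (C := A * Real.sqrt S2 * ‖x‖)
      measure_Ioc_lt_top (ae_of_all _ fun τ _ => by rw [Real.norm_eq_abs]; exact hg τ)
    rw [Real.norm_eq_abs, Measure.real, Real.volume_Ioc, ENNReal.toReal_ofReal hts.le] at h
    exact h
  have hLHS : |⟪U s t x - T s t x, ζ⟫_ℝ| ≤ (t - s) * A * Real.sqrt S2 * ‖x‖ := by
    rw [hA, hid, hxζ, zero_add]
    calc |∫ τ in Ioc s t, g τ| ≤ A * Real.sqrt S2 * ‖x‖ * (t - s) := hint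
      _ = (t - s) * A * Real.sqrt S2 * ‖x‖ := by ring
  -- Step C: the currency (the window length is `≤ τ⋆`: every slow mode and the lowest fast mode are unsaturated)
  set L : ℝ := loT lo Λ c ν n with hLdef
  set y₁ : ℝ := 8 * Real.pi ^ 2 * L * (N₄ : ℝ) ^ 2 * (t - s) with hy₁
  have hy₁1 : y₁ ≤ 1 := hshort
  have hy₁0 : 0 ≤ y₁ := by positivity
  -- forward loss of the fast datum
  have hqx : y₁ / 2 * ‖x‖ ^ 2 ≤ lossFwd (T s t) x := by
    have hsupp : ∀ k', fc x k' ≠ 0 → ((N₄ : ℝ)) ^ 2 ≤ Torus.freqNormSq k' := by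
      intro k' hk'
      by_contra hlt
      exact hk' (hx k' (Torus.mem_freqBall.2 (le_of_lt (not_le.1 hlt))))
    have h := lossFwd_ge_of_supp hcoarse hloT (fun _ _ => rfl) hT hs hst.le htT x (sq_nonneg (N₄ : ℝ)) hsupp
    have he : y₁ / 2 ≤ 1 - Real.exp (-y₁) := Literature.NumberTheory.LFunctions.PrimeReciprocal.half_le_one_sub_exp_neg hy₁0 hy₁1
    exact (mul_le_mul_of_nonneg_right he (sq_nonneg _)).trans h
  -- adjoint loss of the slow test, mode by mode
  set r : ℝ := 4 * Real.pi ^ 2 * L * (t - s) with hr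
  have hr0 : 0 < r := by positivity
  have hqζ : r * S2 ≤ lossAdj (T s t) ζ := by
    have h := lossAdj_ge_sum_modes hcoarse hloT hT hs hst.le htT ζ' hζ'div (Torus.freqBall N₄)
    have hterm : ∀ k' ∈ Torus.freqBall (d := Fin 3) N₄,
        r * (Torus.freqNormSq k' * ‖mFourierCoeff (EuclideanSpace.complexify ∘ (ζ' : VF)) k'‖ ^ 2)
          ≤ (1 - Real.exp (-(8 * Real.pi ^ 2 * L * Torus.freqNormSq k' * (t - s)))) * ‖fc ζ' k'‖ ^ 2 := by
      intro k' hk'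
      have hkN : Torus.freqNormSq k' ≤ (N₄ : ℝ) ^ 2 := Torus.mem_freqBall.1 hk'
      have hf0 := Torus.freqNormSq_nonneg k'
      have hy0 : 0 ≤ 8 * Real.pi ^ 2 * L * Torus.freqNormSq k' * (t - s) := by positivity
      have hyle : 8 * Real.pi ^ 2 * L * Torus.freqNormSq k' * (t - s) ≤ y₁ := by rw [hy₁]; gcongr
      have he := Literature.NumberTheory.LFunctions.PrimeReciprocal.half_le_one_sub_exp_neg hy0 (hyle.trans hy₁1)
      have e : r * (Torus.freqNormSq k' * ‖mFourierCoeff (EuclideanSpace.complexify ∘ (ζ' : VF)) k'‖ ^ 2)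
          = 8 * Real.pi ^ 2 * L * Torus.freqNormSq k' * (t - s) / 2 * ‖fc ζ' k'‖ ^ 2 := by
        rw [hr, fc]; ring
      rw [e]
      exact mul_le_mul_of_nonneg_right he (sq_nonneg _)
    calc r * S2 = ∑ k' ∈ Torus.freqBall N₄, r * (Torus.freqNormSq k' * ‖mFourierCoeff (EuclideanSpace.complexify ∘ (ζ' : VF)) k'‖ ^ 2) := by
          rw [hS2, Finset.mul_sum]
      _ ≤ ∑ k' ∈ Torus.freqBall N₄, (1 - Real.exp (-(8 * Real.pi ^ 2 * L * Torus.freqNormSq k' * (t - s)))) * ‖fc ζ' k'‖ ^ 2 :=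
          Finset.sum_le_sum hterm
      _ ≤ lossAdj (T s t) ζ' := h
      _ ≤ lossAdj (T s t) ζ := lossAdj_starProjection_le hT s t ζ
  -- square roots
  have hsqx : Real.sqrt r * N₄ * ‖x‖ ≤ Real.sqrt (lossFwd (T s t) x) := by
    have hsq : (Real.sqrt r * N₄ * ‖x‖) ^ 2 ≤ lossFwd (T s t) x := by
      calc (Real.sqrt r * N₄ * ‖x‖) ^ 2 = (Real.sqrt r) ^ 2 * (N₄ : ℝ) ^ 2 * ‖x‖ ^ 2 := by ring
        _ = y₁ / 2 * ‖x‖ ^ 2 := by rw [Real.sq_sqrt hr0.le, hr, hy₁]; ring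
        _ ≤ lossFwd (T s t) x := hqx
    calc Real.sqrt r * N₄ * ‖x‖ = Real.sqrt ((Real.sqrt r * N₄ * ‖x‖) ^ 2) := (Real.sqrt_sq (by positivity)).symm
      _ ≤ Real.sqrt (lossFwd (T s t) x) := Real.sqrt_le_sqrt hsq
  have hsqζ : Real.sqrt r * Real.sqrt S2 ≤ Real.sqrt (lossAdj (T s t) ζ) := by
    rw [← Real.sqrt_mul hr0.le]
    exact Real.sqrt_le_sqrt hqζ
  -- Step D: comparison of the constants
  set Cfs : ℝ := ν * Λ * (k + hi * Λ + β) / (c * lo) with hCfs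
  have hCfs0 : 0 ≤ Cfs := by positivity
  have hprod : Cfs * r * N₄ * Real.sqrt S2 * ‖x‖ ≤ Cfs * Real.sqrt (lossFwd (T s t) x) * Real.sqrt (lossAdj (T s t) ζ) := by
    have h2 : 0 ≤ Real.sqrt r * Real.sqrt S2 := by positivity
    have hrr : Real.sqrt r * Real.sqrt r = r := Real.mul_self_sqrt hr0.le
    have e1 : (Real.sqrt r * N₄ * ‖x‖) * (Real.sqrt r * Real.sqrt S2) = r * N₄ * Real.sqrt S2 * ‖x‖ := by
      have e0 : (Real.sqrt r * N₄ * ‖x‖) * (Real.sqrt r * Real.sqrt S2) = (Real.sqrt r * Real.sqrt r) * N₄ * Real.sqrt S2 * ‖x‖ := by ring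
      rw [e0, hrr]
    calc Cfs * r * N₄ * Real.sqrt S2 * ‖x‖
        = Cfs * ((Real.sqrt r * N₄ * ‖x‖) * (Real.sqrt r * Real.sqrt S2)) := by rw [e1]; ring
      _ ≤ Cfs * (Real.sqrt (lossFwd (T s t) x) * Real.sqrt (lossAdj (T s t) ζ)) :=
          mul_le_mul_of_nonneg_left (mul_le_mul hsqx hsqζ h2 (Real.sqrt_nonneg _)) hCfs0
      _ = Cfs * Real.sqrt (lossFwd (T s t) x) * Real.sqrt (lossAdj (T s t) ζ) := by ring
  refine hLHS.trans (le_trans ?_ hprod)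
  by_cases hN0 : N₄ = 0
  · -- `n < 4`: the only slow mode is the mean, `S2 = 0`
    have hS20 : S2 = 0 := by
      rw [hS2]
      refine Finset.sum_eq_zero fun k' hk' => ?_
      have hk0 : Torus.freqNormSq k' ≤ 0 := by
        have h := Torus.mem_freqBall.1 hk'
        rw [hN0] at h
        simpa using h
      rw [le_antisymm hk0 (Torus.freqNormSq_nonneg k'), zero_mul]
    rw [hS20, Real.sqrt_zero]
    simp
  · have hn4 : 4 ≤ n := by
      by_contra h
      exact hN0 (Nat.div_eq_of_lt (not_le.1 h))
    have hn7 : (n : ℝ) ≤ 7 * (N₄ : ℝ) := nat_le_seven_mul_div_four hn4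
    have hL : (c / ν) * (lo / Λ) / (n:ℝ) ^ 2 ≤ L := by
      rw [hLdef]; unfold loT
      rw [div_eq_mul_one_div ((c / ν) * (lo / Λ)) ((n:ℝ) ^ 2), mul_comm ((c / ν) * (lo / Λ))]
      refine mul_le_mul_of_nonneg_left ?_ hn2.le
      have : 0 ≤ ν * (lo / Λ) := by positivity
      nlinarith
    have hkey : A ≤ Cfs * (4 * Real.pi ^ 2 * L) * N₄ :=
      fs_const_le hν0 hν1 hc hlo hΛ1 hhi0 hβ (Nat.cast_nonneg k) hn0 (Nat.cast_nonneg N₄) hn7 hlam0.le hlam.2 hL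
    have hfac : 0 ≤ (t - s) * (Real.sqrt S2 * ‖x‖) := by positivity
    calc (t - s) * A * Real.sqrt S2 * ‖x‖ = A * ((t - s) * (Real.sqrt S2 * ‖x‖)) := by ring
      _ ≤ (Cfs * (4 * Real.pi ^ 2 * L) * N₄) * ((t - s) * (Real.sqrt S2 * ‖x‖)) := mul_le_mul_of_nonneg_right hkey hfac
      _ = Cfs * r * N₄ * Real.sqrt S2 * ‖x‖ := by rw [hr]; ring

end Summit.AnomalousDissipation.AnomalousDissipation.Theorems.SolenoidalFractalHomogenisation.LagrangianStep.VmodFlat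

end
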